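import Summits.Ventures.PercRepro.Reduced
import Summits.Ventures.PercRepro.DeadEdges

/-!
# C-005 for every marked multigraph that series–parallel-reduces to at most eight live edges

A **reduction step** (`SPStep a b c d`) replaces a series pair at an UNMARKED vertex of degree two
(`IsSeries`, `Series.lean`: `e₁ = {y, x}`, `e₂ = {x, z}` become one edge `y–z` of weight
`p₁ p₂`, `e₂` dead) or a parallel pair (`Parallel.lean`: one edge of weight
`1 − (1 − p₁)(1 − p₂)`, `e₂` dead). Every partition probability of the four marks is unchanged by
a step (`IsSeries.prob_partitionEvent`, `prob_partitionEvent_parallel`), so the C-005 inequality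
transports backwards along any chain of steps (`C005At_of_step`, `C005At_of_reduces'`); the chain
strictly shrinks the set of live edges, and when at most eight edges are left alive the ≤ 8-edge
theorem applies after deleting the dead ones (`C005_of_card_liveEdges_le_eight`, `DeadEdges.lean`).

**`C005At_of_reduces`**: C-005 holds at every weight vector for every marked multigraph that
series–parallel-reduces (at unmarked vertices) to an instance with at most eight live edges —
an infinite family of networks at all `p`: every subdivided `K₄` (six internally disjoint
terminal paths of any lengths, plus parallel copies), every network whose two-terminal reduction
between the marks has ≤ 8 edges.
-/

namespace PercRepro

namespace MultiGraph

variable {V E : Type} [Fintype E] [DecidableEq E]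

/-- The C-005 inequality for the marked multigraph `G` at the weight `p` and the marks
`a, b, c, d`: `x₁x₂ + x₁x₃ + x₂x₃ ≤ top · bot`. -/
def C005At (G : MultiGraph V E) (p : E → ℝ) (a b c d : V) : Prop :=
  prob p (G.partitionEvent ![a, b, c, d] ![0, 0, 1, 1]) *
      prob p (G.partitionEvent ![a, b, c, d] ![0, 1, 0, 1]) +
    prob p (G.partitionEvent ![a, b, c, d] ![0, 0, 1, 1]) *
      prob p (G.partitionEvent ![a, b, c, d] ![0, 1, 1, 0]) +
    prob p (G.partitionEvent ![a, b, c, d] ![0, 1, 0, 1]) *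
      prob p (G.partitionEvent ![a, b, c, d] ![0, 1, 1, 0]) ≤
  prob p (G.partitionEvent ![a, b, c, d] ![0, 0, 0, 0]) *
    prob p (G.partitionEvent ![a, b, c, d] ![0, 1, 2, 3])

/-- **A series–parallel reduction step** of an instance `(G, p)` with marks `a, b, c, d`: a series
pair at an unmarked vertex, or a parallel pair. -/
inductive SPStep (a b c d : V) : MultiGraph V E × (E → ℝ) → MultiGraph V E × (E → ℝ) → Prop
  | series {G : MultiGraph V E} {p : E → ℝ} {e₁ e₂ : E} {x y z : V} (hs : G.IsSeries e₁ e₂ x y z)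
      (hx : x ≠ a ∧ x ≠ b ∧ x ≠ c ∧ x ≠ d) :
      SPStep a b c d (G, p) (G.seriesGraph e₁ y z, serWeight p e₁ e₂)
  | parallel {G : MultiGraph V E} {p : E → ℝ} {e₁ e₂ : E} (hne : e₁ ≠ e₂) (hpar : G.Parallel e₁ e₂) :
      SPStep a b c d (G, p) (G, parWeight p e₁ e₂)

/-- **Reduction**: the reflexive–transitive closure of the steps. -/
def Reduces (a b c d : V) : MultiGraph V E × (E → ℝ) → MultiGraph V E × (E → ℝ) → Prop :=
  Relation.ReflTransGen (SPStep a b c d)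

omit [Fintype E] in
/-- A step preserves probability vectors. -/
theorem SPStep.isProb {a b c d : V} {x y : MultiGraph V E × (E → ℝ)} (h : SPStep a b c d x y)
    (hp : IsProb x.2) : IsProb y.2 := by
  cases h with
  | series hs hx => exact isProb_serWeight hp _ _
  | parallel hne hpar => exact isProb_parWeight hp _ _

omit [Fintype E] in
/-- A reduction preserves probability vectors. -/
theorem Reduces.isProb {a b c d : V} {x y : MultiGraph V E × (E → ℝ)} (h : Reduces a b c d x y)
    (hp : IsProb x.2) : IsProb y.2 := by
  induction h with
  | refl => exact hp
  | tail _ hstep ih => exact hstep.isProb ih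

/-- The four marks avoid the unmarked vertex of a series step. -/
theorem marks_ne_of_ne {a b c d x : V} (hx : x ≠ a ∧ x ≠ b ∧ x ≠ c ∧ x ≠ d) :
    ∀ i : Fin 4, (![a, b, c, d] : Fin 4 → V) i ≠ x := by
  intro i
  fin_cases i
  · exact hx.1.symm
  · exact hx.2.1.symm
  · exact hx.2.2.1.symm
  · exact hx.2.2.2.symm

/-- **C-005 transports backwards along a step**: the five partition probabilities are unchanged. -/
theorem C005At_of_step {a b c d : V} {x y : MultiGraph V E × (E → ℝ)} (h : SPStep a b c d x y)
    (hy : y.1.C005At y.2 a b c d) : x.1.C005At x.2 a b c d := by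
  cases h with
  | @series G p e₁ e₂ x y z hs hx =>
    unfold C005At at hy ⊢
    have hm := marks_ne_of_ne hx
    rw [hs.prob_partitionEvent p hm ![0, 0, 1, 1], hs.prob_partitionEvent p hm ![0, 1, 0, 1],
      hs.prob_partitionEvent p hm ![0, 1, 1, 0], hs.prob_partitionEvent p hm ![0, 0, 0, 0],
      hs.prob_partitionEvent p hm ![0, 1, 2, 3]]
    exact hy
  | @parallel G p e₁ e₂ hne hpar =>
    unfold C005At at hy ⊢
    rw [G.prob_partitionEvent_parallel hne hpar p ![a, b, c, d] ![0, 0, 1, 1],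
      G.prob_partitionEvent_parallel hne hpar p ![a, b, c, d] ![0, 1, 0, 1],
      G.prob_partitionEvent_parallel hne hpar p ![a, b, c, d] ![0, 1, 1, 0],
      G.prob_partitionEvent_parallel hne hpar p ![a, b, c, d] ![0, 0, 0, 0],
      G.prob_partitionEvent_parallel hne hpar p ![a, b, c, d] ![0, 1, 2, 3]]
    exact hy

/-- **C-005 transports backwards along a reduction.** -/
theorem C005At_of_reduces' {a b c d : V} {x y : MultiGraph V E × (E → ℝ)} (h : Reduces a b c d x y)
    (hy : y.1.C005At y.2 a b c d) : x.1.C005At x.2 a b c d := by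
  induction h using Relation.ReflTransGen.head_induction_on with
  | refl => exact hy
  | head hstep _ ih => exact C005At_of_step hstep ih

/-- The ≤ 8-live-edge theorem in the `C005At` form. -/
theorem C005At_of_card_liveEdges_le_eight (G : MultiGraph V E) {p : E → ℝ} (hp : IsProb p)
    (hlive : (liveEdges p).card ≤ 8) (a b c d : V) : G.C005At p a b c d := by
  classical
  refine G.C005_of_card_liveEdges_le_eight p hp ?_ a b c d
  have : (Finset.univ.filter fun e => p e ≠ 0) = liveEdges p := by
    ext e
    rw [mem_liveEdges]
    simp
  rw [this]
  exact hlive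

/-- **C-005 for every instance that series–parallel-reduces to at most eight live edges**: if
`(G, p)` reduces by series steps at unmarked vertices and parallel steps to `(G', p')` with
`|liveEdges p'| ≤ 8`, then the C-005 inequality holds for `G` at `p` and the marks `a, b, c, d`. -/
theorem C005At_of_reduces {a b c d : V} {G G' : MultiGraph V E} {p p' : E → ℝ} (hp : IsProb p)
    (h : Reduces a b c d (G, p) (G', p')) (hlive : (liveEdges p').card ≤ 8) :
    G.C005At p a b c d :=
  C005At_of_reduces' h (G'.C005At_of_card_liveEdges_le_eight (h.isProb hp) hlive a b c d)

end MultiGraph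

end PercRepro
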